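import Literature.Topology.FourManifolds.TrisectionsMiddleCharts
import Literature.Topology.FourManifolds.TrisectionsSectorsOneThree
import HarnessLib

/-!
# The sectors of the height and the top height: corner-slice atlases along the central surface

Topic `Literature/Topology/FourManifolds`; step F (part i) of a Morse-theoretic construction of
Gay–Kirby's trisection for the fact seat
`provefact-Literature.Topology.FourManifolds.exists_isBalancedGKTrisection` (Gay–Kirby 2016,
Thm. 4 via §4, Lemma 14).  Everything in this file is **proved**; the definitions are explicit
(data structure, frames, charts, atlases).

The three sectors `X₁ = {s ≤ 0, 2s ≤ T}`, `X₂ = {0 ≤ s ≤ T}`, `X₃ = {T ≤ 2s, T ≤ s}` of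
`TrisectionsSectorsOneThree.lean` (`s = f - a`, `T` a smooth *top height*), over a bi-collar
`B` of the central surface `F ⊂ Y = f⁻¹(a)` (`TrisectionsBiCollar.lean`: coordinates `s`,
`r = g - b`) on whose box the top height is **linear**, `T = -λ r` (`BiCollar.TwoFnData`): near
`F` the sectors are the wedges of the frames `(1, 0; -1, -λ)`, `(-1, 0; -1, -λ/2)`,
`(1, λ/2; 1, λ)` (`mem_S₂_iff_of_mem_box`, …), so `BiCollar.cornerSliceChart` gives corner-slice
charts along `F`; off `F`, at interior points the translated interior charts
(`BiCollar.interiorChart`) and at face points the straightening charts of the regular face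
functions `a - f`, `(f - a) - T`, `f - a`, `2(f - a) - T`, … (`exists_halfSliceChart_of_not_isMCriticalPt'`).
Results: the three **corner-slice atlases** `TwoFnData.atlas₁/₂/₃`
(`Literature.Topology.FourManifolds.CornerSliceAtlas`), hence by
`CornerSliceAtlas.sector_smooth_clause` the smooth items of clause (ii) of
`Literature.Topology.FourManifolds.IsGKTrisection` for each sector; and the characterisation of
the boundary points of the straightened sectors as the points of the faces
(`isBoundaryPoint₂_iff`, …).

## References

* D. Gay, R. Kirby, *Trisecting 4-manifolds*, Geom. Topol. 20 (2016), Def. 1, Fig. 1; §4, Lemma 14. [GayKirby2016]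
* J. Milnor, *Morse theory* (1963), Thm. 3.1. [Milnor1963]
* A. Douady, *Variétés à bord anguleux et voisinages tubulaires*, Sém. H. Cartan 14 (1961/62), exp. 1. [Douady1961]
-/

open scoped Manifold ContDiff Topology
open Set Function Filter

noncomputable section

universe u

namespace Literature.Topology.FourManifolds

/-- Local notation: `𝔼 n` is the model Euclidean space `EuclideanSpace ℝ (Fin n)`. -/
local notation "𝔼 " n:arg => EuclideanSpace ℝ (Fin n)

variable {X : Type u} [TopologicalSpace X] [T2Space X] [CompactSpace X]
  [ChartedSpace (𝔼 4) X] [IsManifold (𝓡 4) ∞ X]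

namespace BiCollar

variable (B : BiCollar X)

omit [T2Space X] [CompactSpace X] in
/-- `f` is continuous. [folklore] -/
theorem continuous_f' : Continuous B.f := B.hf.contMDiff.continuous

/-- The open set `{s > 0} ∖ F`. [folklore] -/
def sPos : Set X := {x | 0 < B.f x - B.a} ∩ B.surfaceᶜ

/-- The open set `{s < 0} ∖ F`. [folklore] -/
def sNeg : Set X := {x | B.f x - B.a < 0} ∩ B.surfaceᶜ

/-- `sPos` is open. [folklore] -/
theorem isOpen_sPos : IsOpen B.sPos :=
  (isOpen_lt continuous_const (B.continuous_f'.sub continuous_const)).inter B.isClosed_surface.isOpen_compl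

/-- `sNeg` is open. [folklore] -/
theorem isOpen_sNeg : IsOpen B.sNeg :=
  (isOpen_lt (B.continuous_f'.sub continuous_const) continuous_const).inter B.isClosed_surface.isOpen_compl

omit [T2Space X] [CompactSpace X] in
/-- `a - f` is smooth. [folklore] -/
theorem contMDiff_a_sub_f : ContMDiff (𝓡 4) 𝓘(ℝ, ℝ) ∞ fun y => B.a - B.f y := contMDiff_const.sub B.hf.contMDiff

omit [T2Space X] [CompactSpace X] in
/-- `f - a` is smooth. [folklore] -/
theorem contMDiff_f_sub_a : ContMDiff (𝓡 4) 𝓘(ℝ, ℝ) ∞ fun y => B.f y - B.a := B.hf.contMDiff.sub contMDiff_const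

omit [T2Space X] [CompactSpace X] in
/-- `a - f` is regular on the level. [folklore] -/
theorem not_isMCriticalPt_a_sub_f {p : X} (hp : B.f p = B.a) : ¬ IsMCriticalPt (𝓡 4) (fun y => B.a - B.f y) p := by
  have hmd : MDifferentiableAt (𝓡 4) 𝓘(ℝ, ℝ) B.f p := B.hf.contMDiff.mdifferentiableAt (by simp)
  have hφ : HasDerivAt (fun q : ℝ => B.a - q) (-1) (B.f p) := by simpa using (hasDerivAt_id (B.f p)).const_sub B.a
  rw [isMCriticalPt_real_comp_iff' hφ (by norm_num) hmd]
  exact B.hf.not_isMCriticalPt hp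

omit [T2Space X] [CompactSpace X] in
/-- `f - a` is regular on the level. [folklore] -/
theorem not_isMCriticalPt_f_sub_a {p : X} (hp : B.f p = B.a) : ¬ IsMCriticalPt (𝓡 4) (fun y => B.f y - B.a) p := by
  have hmd : MDifferentiableAt (𝓡 4) 𝓘(ℝ, ℝ) B.f p := B.hf.contMDiff.mdifferentiableAt (by simp)
  have hφ : HasDerivAt (fun q : ℝ => q - B.a) 1 (B.f p) := by simpa using (hasDerivAt_id (B.f p)).sub_const B.a
  rw [isMCriticalPt_real_comp_iff' hφ one_ne_zero hmd]
  exact B.hf.not_isMCriticalPt hp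

/-- **Two-function sector data over a bi-collar**: a smooth top height `T`, linear in the
transverse coordinate on the bi-collar box (`T = -λ r`, `λ > 0`), and regularity of the two
slanted face functions off the level. [cite: GayKirby2016, §4, Lemma 14] -/
structure TwoFnData where
  /-- The top height. -/
  T : X → ℝ
  /-- It is smooth. -/
  contMDiff_T : ContMDiff (𝓡 4) 𝓘(ℝ, ℝ) ∞ T
  /-- The slope at the central surface. -/
  lam : ℝ
  /-- The slope is positive. -/
  lam_pos : 0 < lam
  /-- The radius of the wedge box. -/
  εw : ℝ
  /-- The radius is positive. -/
  εw_pos : 0 < εw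
  /-- The box lies in the band of `U`. -/
  εw_le_δU : εw ≤ B.U.δ
  /-- The box lies in the band of `V`. -/
  εw_le_δV : εw ≤ B.V.δ
  /-- On the box the top height is linear: `T = -λ r`. -/
  T_box : ∀ x ∈ B.box εw, T x = -lam * B.rFun x
  /-- Off the surface, `s = 0` forces `T ≠ 0`: the corner locus `{s = 0, T = 0}` is the surface. -/
  surface_of : ∀ x, B.f x = B.a → T x = 0 → x ∈ B.surface
  /-- The face function `(f - a) - T` is regular on its zero set off the level. -/
  reg₁ : ∀ x, T x = B.f x - B.a → B.f x ≠ B.a → ¬ IsMCriticalPt (𝓡 4) (fun y => (B.f y - B.a) - T y) x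
  /-- The face function `2(f - a) - T` is regular on its zero set off the level. -/
  reg₂ : ∀ x, T x = 2 * (B.f x - B.a) → B.f x ≠ B.a → ¬ IsMCriticalPt (𝓡 4) (fun y => 2 * (B.f y - B.a) - T y) x

namespace TwoFnData

variable {B} (D : B.TwoFnData)

/-- The first sector `X₁ = {s ≤ 0, 2s ≤ T}`. [cite: GayKirby2016, §4, Lemma 14] -/
def S₁ : Set X := sectorOne B.f B.a D.T
/-- The second sector `X₂ = {0 ≤ s ≤ T}`. [cite: GayKirby2016, §4, Lemma 14] -/
def S₂ : Set X := sectorTwo B.f B.a D.T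
/-- The third sector `X₃ = {T ≤ 2s, T ≤ s}`. [cite: GayKirby2016, §4, Lemma 14] -/
def S₃ : Set X := sectorThree B.f B.a D.T

/-- Membership in `X₁`. [folklore] -/
theorem mem_S₁ {x : X} : x ∈ D.S₁ ↔ B.f x - B.a ≤ 0 ∧ 2 * (B.f x - B.a) ≤ D.T x := Iff.rfl
/-- Membership in `X₂`. [folklore] -/
theorem mem_S₂ {x : X} : x ∈ D.S₂ ↔ 0 ≤ B.f x - B.a ∧ B.f x - B.a ≤ D.T x := Iff.rfl
/-- Membership in `X₃`. [folklore] -/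
theorem mem_S₃ {x : X} : x ∈ D.S₃ ↔ D.T x ≤ 2 * (B.f x - B.a) ∧ D.T x ≤ B.f x - B.a := Iff.rfl

/-- `T` is continuous. [folklore] -/
theorem continuous_T : Continuous D.T := D.contMDiff_T.continuous

/-- `X₁` is closed. [folklore] -/
theorem isClosed_S₁ : IsClosed D.S₁ := isClosed_sectorOne B.continuous_f' D.continuous_T
/-- `X₂` is closed. [folklore] -/
theorem isClosed_S₂ : IsClosed D.S₂ := isClosed_sectorTwo B.continuous_f' D.continuous_T
/-- `X₃` is closed. [folklore] -/
theorem isClosed_S₃ : IsClosed D.S₃ := isClosed_sectorThree B.continuous_f' D.continuous_T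

/-- The central surface is `{s = 0, T = 0}` … and meets the box in `{s = 0, r = 0}`; globally
we use the bi-collar's surface `F`. On the box: `x ∈ F ↔ s = 0 ∧ r = 0`. [folklore] -/
theorem mem_surface_iff_of_mem_box : ∀ x ∈ B.box D.εw, x ∈ B.surface ↔ B.sFun x = 0 ∧ B.rFun x = 0 :=
  fun x _ => B.mem_surface_iff x

/-- On the surface `s = 0` and `T = 0`. [folklore] -/
theorem sFun_eq_zero_and_T_eq_zero_of_mem_surface {x : X} (hx : x ∈ B.surface) : B.sFun x = 0 ∧ D.T x = 0 := by
  obtain ⟨hs, hr⟩ := (B.mem_surface_iff x).1 hx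
  refine ⟨hs, ?_⟩
  rw [D.T_box x (B.mem_box_of_mem_surface D.εw_pos hx), hr, mul_zero]

/-! ### The frames and the wedges on the box -/

/-- The frame of `X₂`: `u = s`, `v = -s - λ r`. [cite: GayKirby2016, Fig. 1] -/
def W₂ : WedgeFrame where
  α := 1
  β := 0
  γ := -1
  δ := -D.lam
  det_ne_zero := by have := D.lam_pos; norm_num; try nlinarith

/-- The frame of `X₁`: `u = -s`, `v = -s - (λ/2) r`. [cite: GayKirby2016, Fig. 1] -/
def W₁ : WedgeFrame where
  α := -1
  β := 0
  γ := -1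
  δ := -D.lam / 2
  det_ne_zero := by have := D.lam_pos; norm_num; try nlinarith

/-- The frame of `X₃`: `u = s + (λ/2) r`, `v = s + λ r`. [cite: GayKirby2016, Fig. 1] -/
def W₃ : WedgeFrame where
  α := 1
  β := D.lam / 2
  γ := 1
  δ := D.lam
  det_ne_zero := by have := D.lam_pos; norm_num; try nlinarith

/-- `u₂ = s`. [folklore] -/
theorem uFun_W₂ (x : X) : B.uFun D.W₂ x = B.sFun x := by simp [BiCollar.uFun, WedgeFrame.u, W₂]
/-- `v₂ = -s - λ r`. [folklore] -/
theorem vFun_W₂ (x : X) : B.vFun D.W₂ x = -B.sFun x - D.lam * B.rFun x := by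
  simp [BiCollar.vFun, WedgeFrame.v, W₂]; ring
/-- `u₁ = -s`. [folklore] -/
theorem uFun_W₁ (x : X) : B.uFun D.W₁ x = -B.sFun x := by simp [BiCollar.uFun, WedgeFrame.u, W₁]
/-- `v₁ = -s - (λ/2) r`. [folklore] -/
theorem vFun_W₁ (x : X) : B.vFun D.W₁ x = -B.sFun x - D.lam / 2 * B.rFun x := by
  simp [BiCollar.vFun, WedgeFrame.v, W₁]; ring
/-- `u₃ = s + (λ/2) r`. [folklore] -/
theorem uFun_W₃ (x : X) : B.uFun D.W₃ x = B.sFun x + D.lam / 2 * B.rFun x := by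
  simp [BiCollar.uFun, WedgeFrame.u, W₃]
/-- `v₃ = s + λ r`. [folklore] -/
theorem vFun_W₃ (x : X) : B.vFun D.W₃ x = B.sFun x + D.lam * B.rFun x := by
  simp [BiCollar.vFun, WedgeFrame.v, W₃]

omit [T2Space X] [CompactSpace X] in
/-- `s = f - a`. [folklore] -/
theorem sFun_eq (x : X) : B.sFun x = B.f x - B.a := rfl

/-- **On the box, `X₂` is the wedge of `W₂`.** [cite: GayKirby2016, Fig. 1] -/
theorem mem_S₂_iff_of_mem_box : ∀ x ∈ B.box D.εw, x ∈ D.S₂ ↔ 0 ≤ B.uFun D.W₂ x ∧ 0 ≤ B.vFun D.W₂ x := by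
  intro x hx
  rw [D.mem_S₂, uFun_W₂, vFun_W₂, D.T_box x hx, sFun_eq]
  constructor
  · rintro ⟨h1, h2⟩; exact ⟨by linarith, by linarith⟩
  · rintro ⟨h1, h2⟩; exact ⟨by linarith, by linarith⟩

/-- **On the box, `X₁` is the wedge of `W₁`.** [cite: GayKirby2016, Fig. 1] -/
theorem mem_S₁_iff_of_mem_box : ∀ x ∈ B.box D.εw, x ∈ D.S₁ ↔ 0 ≤ B.uFun D.W₁ x ∧ 0 ≤ B.vFun D.W₁ x := by
  intro x hx
  rw [D.mem_S₁, uFun_W₁, vFun_W₁, D.T_box x hx, sFun_eq]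
  constructor
  · rintro ⟨h1, h2⟩; exact ⟨by linarith, by linarith⟩
  · rintro ⟨h1, h2⟩; exact ⟨by linarith, by linarith⟩

/-- **On the box, `X₃` is the wedge of `W₃`.** [cite: GayKirby2016, Fig. 1] -/
theorem mem_S₃_iff_of_mem_box : ∀ x ∈ B.box D.εw, x ∈ D.S₃ ↔ 0 ≤ B.uFun D.W₃ x ∧ 0 ≤ B.vFun D.W₃ x := by
  intro x hx
  rw [D.mem_S₃, uFun_W₃, vFun_W₃, D.T_box x hx, sFun_eq]
  constructor
  · rintro ⟨h1, h2⟩; exact ⟨by linarith, by linarith⟩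
  · rintro ⟨h1, h2⟩; exact ⟨by linarith, by linarith⟩

/-! ### Half-slice charts off the surface -/

/-- The straightening chart of a smooth function `G` at a regular point, transferred to a set
which is `{G ≤ 0}` on an open set `U`. [cite: Milnor1963, Thm. 3.1] -/
def faceChart {G : X → ℝ} (hG : ContMDiff (𝓡 4) 𝓘(ℝ, ℝ) ∞ G) {p : X} (hp : ¬ IsMCriticalPt (𝓡 4) G p)
    (S U : Set X) (hU : IsOpen U) (hSU : ∀ q ∈ U, q ∈ S ↔ q ∈ G ⁻¹' Iic (0 : ℝ)) : HalfSliceChart (𝓡 4) S :=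
  (Classical.choose (exists_halfSliceChart_of_not_isMCriticalPt' hG 0 hp)).restrCongr U hU hSU

omit [T2Space X] [CompactSpace X] in
/-- The point lies in the source of its face chart. [folklore] -/
theorem mem_faceChart_source {G : X → ℝ} (hG : ContMDiff (𝓡 4) 𝓘(ℝ, ℝ) ∞ G) {p : X}
    (hp : ¬ IsMCriticalPt (𝓡 4) G p) (S U : Set X) (hU : IsOpen U)
    (hSU : ∀ q ∈ U, q ∈ S ↔ q ∈ G ⁻¹' Iic (0 : ℝ)) (hpU : p ∈ U) : p ∈ (faceChart hG hp S U hU hSU).Θ.source :=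
  ⟨(Classical.choose_spec (exists_halfSliceChart_of_not_isMCriticalPt' hG 0 hp)).1, hpU⟩

omit [T2Space X] [CompactSpace X] in
/-- The source of a face chart lies in the open set. [folklore] -/
theorem faceChart_source_subset {G : X → ℝ} (hG : ContMDiff (𝓡 4) 𝓘(ℝ, ℝ) ∞ G) {p : X}
    (hp : ¬ IsMCriticalPt (𝓡 4) G p) (S U : Set X) (hU : IsOpen U)
    (hSU : ∀ q ∈ U, q ∈ S ↔ q ∈ G ⁻¹' Iic (0 : ℝ)) : (faceChart hG hp S U hU hSU).Θ.source ⊆ U :=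
  fun _ hq => hq.2

omit [T2Space X] [CompactSpace X] in
/-- In a face chart the `0`-th coordinate is `-G`. [cite: Milnor1963, Thm. 3.1] -/
theorem faceChart_apply_zero {G : X → ℝ} (hG : ContMDiff (𝓡 4) 𝓘(ℝ, ℝ) ∞ G) {p : X}
    (hp : ¬ IsMCriticalPt (𝓡 4) G p) (S U : Set X) (hU : IsOpen U)
    (hSU : ∀ q ∈ U, q ∈ S ↔ q ∈ G ⁻¹' Iic (0 : ℝ)) {q : X} (hq : q ∈ (faceChart hG hp S U hU hSU).Θ.source) :
    (faceChart hG hp S U hU hSU).Θ q 0 = -G q := by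
  have h := (Classical.choose_spec (exists_halfSliceChart_of_not_isMCriticalPt' hG 0 hp)).2 q hq.1
  rw [zero_sub] at h
  exact h

/-! #### The faces of `X₂`: `{s = 0}` over `{T - s > 0}` and `{s = T}` over `{s > 0}` -/

/-- The open set `{T - s > 0} ∖ F`. [folklore] -/
def U₂a : Set X := {x | 0 < D.T x - (B.f x - B.a)} ∩ B.surfaceᶜ
/-- `U₂a` is open. [folklore] -/
theorem isOpen_U₂a : IsOpen D.U₂a :=
  (isOpen_lt continuous_const (D.continuous_T.sub (B.continuous_f'.sub continuous_const))).inter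
    B.isClosed_surface.isOpen_compl
/-- On `U₂a`, `X₂ = {a - f ≤ 0}`. [folklore] -/
theorem S₂_iff_U₂a : ∀ q ∈ D.U₂a, q ∈ D.S₂ ↔ q ∈ (fun y => B.a - B.f y) ⁻¹' Iic (0 : ℝ) := by
  intro q hq
  simp only [mem_S₂, mem_preimage, mem_Iic]
  have := hq.1
  constructor
  · rintro ⟨h1, _⟩; linarith
  · intro h; exact ⟨by linarith, by simp only [mem_setOf_eq] at this; linarith⟩

/-- On `U₂b`, `X₂ = {(f - a) - T ≤ 0}`. [folklore] -/
theorem S₂_iff_U₂b : ∀ q ∈ B.sPos, q ∈ D.S₂ ↔ q ∈ (fun y => (B.f y - B.a) - D.T y) ⁻¹' Iic (0 : ℝ) := by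
  intro q hq
  simp only [mem_S₂, mem_preimage, mem_Iic]
  have h0 : 0 < B.f q - B.a := hq.1
  constructor
  · rintro ⟨_, h2⟩; linarith
  · intro h; exact ⟨h0.le, by linarith⟩

/-- `(f - a) - T` is smooth. [folklore] -/
theorem contMDiff_s_sub_T : ContMDiff (𝓡 4) 𝓘(ℝ, ℝ) ∞ fun y => (B.f y - B.a) - D.T y :=
  (B.hf.contMDiff.sub contMDiff_const).sub D.contMDiff_T

/-- **The half-slice chart at a point of `X₂` off the surface**: interior chart at interior
points, straightening chart of `a - f` at points of the face `{s = 0}`, of `(f - a) - T` at points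
of the face `{s = T}`. [cite: Milnor1963, Thm. 3.1] [cite: GayKirby2016, Def. 1] -/
def halfChart₂ (p : X) (_hp : p ∈ D.S₂) (_hpF : p ∉ B.surface) : HalfSliceChart (𝓡 4) D.S₂ :=
  if hs : B.f p - B.a = 0 then
    faceChart B.contMDiff_a_sub_f (B.not_isMCriticalPt_a_sub_f (by linarith)) D.S₂ D.U₂a D.isOpen_U₂a D.S₂_iff_U₂a
  else if hT : D.T p = B.f p - B.a then
    faceChart D.contMDiff_s_sub_T (D.reg₁ p hT (fun h => hs (by linarith))) D.S₂ B.sPos B.isOpen_sPos D.S₂_iff_U₂b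
  else B.interiorChart D.S₂ p

/-- A point of `X₂` off the surface with `s = 0` has `T - s > 0`. [folklore] -/
theorem T_sub_pos_of_s_eq_zero {p : X} (hp : p ∈ D.S₂) (hpF : p ∉ B.surface) (hs : B.f p - B.a = 0) :
    0 < D.T p - (B.f p - B.a) := by
  rcases (sub_nonneg.2 hp.2).eq_or_lt with h | h
  · exact absurd (D.surface_of p (by linarith) (by linarith)) hpF
  · exact h

/-- A point of `X₂` off the surface with `s ≠ 0` has `s > 0`. [folklore] -/
theorem s_pos_of_s_ne_zero {p : X} (hp : p ∈ D.S₂) (hs : B.f p - B.a ≠ 0) : 0 < B.f p - B.a :=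
  lt_of_le_of_ne hp.1 (Ne.symm hs)

/-- The given point lies in the source of its half-slice chart. [folklore] -/
theorem mem_halfChart₂_source (p : X) (hp : p ∈ D.S₂) (hpF : p ∉ B.surface) :
    p ∈ (D.halfChart₂ p hp hpF).Θ.source := by
  unfold halfChart₂
  by_cases hs : B.f p - B.a = 0
  · rw [dif_pos hs]
    exact mem_faceChart_source _ _ _ _ _ _ ⟨D.T_sub_pos_of_s_eq_zero hp hpF hs, hpF⟩
  · rw [dif_neg hs]
    by_cases hT : D.T p = B.f p - B.a
    · rw [dif_pos hT]
      exact mem_faceChart_source _ _ _ _ _ _ ⟨D.s_pos_of_s_ne_zero hp hs, hpF⟩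
    · rw [dif_neg hT]
      refine B.mem_interiorChart_source ?_ hpF
      -- interior point: strict inequalities
      have h1 : 0 < B.f p - B.a := D.s_pos_of_s_ne_zero hp hs
      have h2 : B.f p - B.a < D.T p := lt_of_le_of_ne hp.2 (Ne.symm hT)
      have hopen : IsOpen {x | 0 < B.f x - B.a ∧ B.f x - B.a < D.T x} :=
        (isOpen_lt continuous_const (B.continuous_f'.sub continuous_const)).inter
          (isOpen_lt (B.continuous_f'.sub continuous_const) D.continuous_T)
      exact mem_of_superset (hopen.mem_nhds ⟨h1, h2⟩) fun x hx => ⟨hx.1.le, hx.2.le⟩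

/-- The sources of the half-slice charts avoid the surface. [folklore] -/
theorem not_mem_surface_of_mem_halfChart₂_source {p : X} {hp : p ∈ D.S₂} {hpF : p ∉ B.surface} {q : X}
    (hq : q ∈ (D.halfChart₂ p hp hpF).Θ.source) : q ∉ B.surface := by
  unfold halfChart₂ at hq
  by_cases hs : B.f p - B.a = 0
  · rw [dif_pos hs] at hq; exact (faceChart_source_subset _ _ _ _ _ _ hq).2
  · rw [dif_neg hs] at hq
    by_cases hT : D.T p = B.f p - B.a
    · rw [dif_pos hT] at hq; exact (faceChart_source_subset _ _ _ _ _ _ hq).2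
    · rw [dif_neg hT] at hq; exact B.not_mem_surface_of_mem_interiorChart_source hq

open Classical in
/-- **The corner-slice atlas of `X₂`** with corner locus the surface, normal coordinates
`u = s`, `v = -s - λ r` and the bi-collar retraction. [cite: GayKirby2016, Def. 1 and Fig. 1] [cite: Douady1961, §1 and §4] -/
def atlas₂ : CornerSliceAtlas D.S₂ B.surface (B.uFun D.W₂) (B.vFun D.W₂) B.π where
  halfDatum p hp := D.halfChart₂ p.1 p.2 hp
  half_mem_source p hp := D.mem_halfChart₂_source p.1 p.2 hp
  half_not_mem _ _ _ hq := D.not_mem_surface_of_mem_halfChart₂_source hq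
  cornerDatum p _ :=
    B.cornerSliceChart D.W₂ (chartAt (𝔼 2) (B.zL p.1)) D.εw (IsManifold.chart_mem_maximalAtlas _)
      D.εw_pos D.εw_le_δU D.εw_le_δV D.mem_S₂_iff_of_mem_box D.mem_surface_iff_of_mem_box
  corner_mem_source _ hp :=
    B.mem_cornerSliceChart_source D.W₂ D.εw_pos D.εw_le_δU D.εw_le_δV _ _ (B.mem_box_of_mem_surface D.εw_pos hp)

/-- **`X₂` with its angle along `F` straightened satisfies the smooth items of clause (ii).** [cite: GayKirby2016, Def. 1] -/
theorem sector_smooth_clause₂ :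
    letI := D.atlas₂.chartedSpace
    IsManifold (𝓡∂ 4) ∞ D.S₂ ∧ Topology.IsEmbedding (Subtype.val : D.S₂ → X) ∧
      range (Subtype.val : D.S₂ → X) = D.S₂ ∧
      (∀ w : D.S₂, w.1 ∉ B.surface → Manifold.IsImmersionAt (𝓡∂ 4) (𝓡 4) ∞ (Subtype.val : D.S₂ → X) w) ∧
      (∀ w : D.S₂, w.1 ∈ B.surface → IsCornerAt (Subtype.val : D.S₂ → X) w) ∧
      (∀ w : D.S₂, w.1 ∈ B.surface → w ∈ (𝓡∂ 4).boundary D.S₂) :=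
  D.atlas₂.sector_smooth_clause

/-- In the half-slice chart at a point of `X₂` off the surface, the `0`-th coordinate of the
point is `0` on the faces and positive inside. [folklore] -/
theorem halfChart₂_apply_zero_self (p : X) (hp : p ∈ D.S₂) (hpF : p ∉ B.surface) :
    ((D.halfChart₂ p hp hpF).Θ p 0 = 0 ↔ B.f p - B.a = 0 ∨ D.T p = B.f p - B.a) ∧
      (0 < (D.halfChart₂ p hp hpF).Θ p 0 ↔ 0 < B.f p - B.a ∧ B.f p - B.a < D.T p) := by
  have hsrc := D.mem_halfChart₂_source p hp hpF
  unfold halfChart₂ at hsrc ⊢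
  by_cases hs : B.f p - B.a = 0
  · simp only [dif_pos hs] at hsrc ⊢
    rw [faceChart_apply_zero _ _ _ _ _ _ hsrc]
    constructor
    · constructor
      · intro _; exact Or.inl hs
      · intro _; show -(B.a - B.f p) = 0; linarith
    · constructor
      · intro h; exfalso; have : -(B.a - B.f p) > 0 := h; linarith
      · rintro ⟨h1, _⟩; linarith
  · simp only [dif_neg hs] at hsrc ⊢
    by_cases hT : D.T p = B.f p - B.a
    · simp only [dif_pos hT] at hsrc ⊢
      rw [faceChart_apply_zero _ _ _ _ _ _ hsrc]
      constructor
      · constructor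
        · intro _; exact Or.inr hT
        · intro _; show -((B.f p - B.a) - D.T p) = 0; linarith
      · constructor
        · intro h; exfalso; have : -((B.f p - B.a) - D.T p) > 0 := h; linarith
        · rintro ⟨_, h2⟩; linarith
    · simp only [dif_neg hT] at hsrc ⊢
      have hpos := sublevelChartLT'_apply_zero_pos hsrc.1
      constructor
      · constructor
        · intro h; exact absurd h hpos.ne'
        · rintro (h | h); exacts [absurd h hs, absurd h hT]
      · constructor
        · intro _; exact ⟨D.s_pos_of_s_ne_zero hp hs, lt_of_le_of_ne hp.2 (Ne.symm hT)⟩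
        · intro _; exact hpos

/-- **Boundary points of the straightened `X₂` are the points of its two faces** (and of `F`). [cite: GayKirby2016, Def. 1] -/
theorem isBoundaryPoint₂_iff (p : D.S₂) :
    letI := D.atlas₂.chartedSpace
    (𝓡∂ 4).IsBoundaryPoint p ↔ B.f p.1 - B.a = 0 ∨ D.T p.1 = B.f p.1 - B.a := by
  letI := D.atlas₂.chartedSpace
  by_cases hpF : p.1 ∈ B.surface
  · have hb := D.atlas₂.isBoundaryPoint_of_mem p hpF
    exact ⟨fun _ => Or.inl (D.sFun_eq_zero_and_T_eq_zero_of_mem_surface hpF).1, fun _ => hb⟩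
  · rw [D.atlas₂.isBoundaryPoint_iff_of_not_mem p hpF]
    exact (D.halfChart₂_apply_zero_self p.1 p.2 hpF).1

/-- **Interior points of the straightened `X₂` are the points with `0 < s < T`.** [cite: GayKirby2016, Def. 1] -/
theorem isInteriorPoint₂_iff (p : D.S₂) :
    letI := D.atlas₂.chartedSpace
    (𝓡∂ 4).IsInteriorPoint p ↔ 0 < B.f p.1 - B.a ∧ B.f p.1 - B.a < D.T p.1 := by
  letI := D.atlas₂.chartedSpace
  by_cases hpF : p.1 ∈ B.surface
  · have hb := D.atlas₂.isBoundaryPoint_of_mem p hpF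
    have hs := (D.sFun_eq_zero_and_T_eq_zero_of_mem_surface hpF).1
    constructor
    · intro hi; exact absurd hb (((𝓡∂ 4).isInteriorPoint_iff_not_isBoundaryPoint p).1 hi)
    · rintro ⟨h1, _⟩; exfalso; rw [BiCollar.sFun] at hs; linarith
  · rw [D.atlas₂.isInteriorPoint_iff_of_not_mem p hpF]
    exact (D.halfChart₂_apply_zero_self p.1 p.2 hpF).2

/-! ### The first sector -/

/-- The open set `{2s < T} ∖ F`. [folklore] -/
def U₁a : Set X := {x | 2 * (B.f x - B.a) < D.T x} ∩ B.surfaceᶜ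
/-- `U₁a` is open. [folklore] -/
theorem isOpen_U₁a : IsOpen D.U₁a :=
  (isOpen_lt (continuous_const.mul (B.continuous_f'.sub continuous_const)) D.continuous_T).inter
    B.isClosed_surface.isOpen_compl
/-- On `U₁a`, `X₁ = {f - a ≤ 0}`. [folklore] -/
theorem S₁_iff_U₁a : ∀ q ∈ D.U₁a, q ∈ D.S₁ ↔ q ∈ (fun y => B.f y - B.a) ⁻¹' Iic (0 : ℝ) := by
  intro q hq
  simp only [mem_S₁, mem_preimage, mem_Iic]
  have h0 : 2 * (B.f q - B.a) < D.T q := hq.1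
  constructor
  · rintro ⟨h1, _⟩; exact h1
  · intro h; exact ⟨h, h0.le⟩

/-- On `U₁b`, `X₁ = {2(f - a) - T ≤ 0}`. [folklore] -/
theorem S₁_iff_U₁b : ∀ q ∈ B.sNeg, q ∈ D.S₁ ↔ q ∈ (fun y => 2 * (B.f y - B.a) - D.T y) ⁻¹' Iic (0 : ℝ) := by
  intro q hq
  simp only [mem_S₁, mem_preimage, mem_Iic]
  have h0 : B.f q - B.a < 0 := hq.1
  constructor
  · rintro ⟨_, h2⟩; linarith
  · intro h; exact ⟨h0.le, by linarith⟩

/-- `2(f - a) - T` is smooth. [folklore] -/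
theorem contMDiff_2s_sub_T : ContMDiff (𝓡 4) 𝓘(ℝ, ℝ) ∞ fun y => 2 * (B.f y - B.a) - D.T y :=
  (contMDiff_const.mul (B.hf.contMDiff.sub contMDiff_const)).sub D.contMDiff_T

/-- **The half-slice chart at a point of `X₁` off the surface.** [cite: Milnor1963, Thm. 3.1] [cite: GayKirby2016, Def. 1] -/
def halfChart₁ (p : X) (_hp : p ∈ D.S₁) (_hpF : p ∉ B.surface) : HalfSliceChart (𝓡 4) D.S₁ :=
  if hs : B.f p - B.a = 0 then
    faceChart B.contMDiff_f_sub_a (B.not_isMCriticalPt_f_sub_a (by linarith)) D.S₁ D.U₁a D.isOpen_U₁a D.S₁_iff_U₁a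
  else if hT : D.T p = 2 * (B.f p - B.a) then
    faceChart D.contMDiff_2s_sub_T (D.reg₂ p hT (fun h => hs (by linarith))) D.S₁ B.sNeg B.isOpen_sNeg D.S₁_iff_U₁b
  else B.interiorChart D.S₁ p

/-- (see name). [folklore] -/
theorem two_s_lt_T_of_s_eq_zero₁ {p : X} (hp : p ∈ D.S₁) (hpF : p ∉ B.surface) (hs : B.f p - B.a = 0) :
    2 * (B.f p - B.a) < D.T p := by
  rcases hp.2.eq_or_lt with h | h
  · exact absurd (D.surface_of p (by linarith) (by linarith)) hpF
  · exact h

/-- (see name). [folklore] -/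
theorem s_neg_of_s_ne_zero₁ {p : X} (hp : p ∈ D.S₁) (hs : B.f p - B.a ≠ 0) : B.f p - B.a < 0 :=
  lt_of_le_of_ne hp.1 hs

/-- The point lies in the source of its half-slice chart. [folklore] -/
theorem mem_halfChart₁_source (p : X) (hp : p ∈ D.S₁) (hpF : p ∉ B.surface) :
    p ∈ (D.halfChart₁ p hp hpF).Θ.source := by
  unfold halfChart₁
  by_cases hs : B.f p - B.a = 0
  · rw [dif_pos hs]
    exact mem_faceChart_source _ _ _ _ _ _ ⟨D.two_s_lt_T_of_s_eq_zero₁ hp hpF hs, hpF⟩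
  · rw [dif_neg hs]
    by_cases hT : D.T p = 2 * (B.f p - B.a)
    · rw [dif_pos hT]
      exact mem_faceChart_source _ _ _ _ _ _ ⟨D.s_neg_of_s_ne_zero₁ hp hs, hpF⟩
    · rw [dif_neg hT]
      refine B.mem_interiorChart_source ?_ hpF
      have h1 : B.f p - B.a < 0 := D.s_neg_of_s_ne_zero₁ hp hs
      have h2 : 2 * (B.f p - B.a) < D.T p := lt_of_le_of_ne hp.2 (Ne.symm hT)
      have hopen : IsOpen {x | B.f x - B.a < 0 ∧ 2 * (B.f x - B.a) < D.T x} :=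
        (isOpen_lt (B.continuous_f'.sub continuous_const) continuous_const).inter
          (isOpen_lt (continuous_const.mul (B.continuous_f'.sub continuous_const)) D.continuous_T)
      exact mem_of_superset (hopen.mem_nhds ⟨h1, h2⟩) fun x hx => ⟨hx.1.le, hx.2.le⟩

/-- The sources avoid the surface. [folklore] -/
theorem not_mem_surface_of_mem_halfChart₁_source {p : X} {hp : p ∈ D.S₁} {hpF : p ∉ B.surface} {q : X}
    (hq : q ∈ (D.halfChart₁ p hp hpF).Θ.source) : q ∉ B.surface := by
  unfold halfChart₁ at hq
  by_cases hs : B.f p - B.a = 0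
  · rw [dif_pos hs] at hq; exact (faceChart_source_subset _ _ _ _ _ _ hq).2
  · rw [dif_neg hs] at hq
    by_cases hT : D.T p = 2 * (B.f p - B.a)
    · rw [dif_pos hT] at hq; exact (faceChart_source_subset _ _ _ _ _ _ hq).2
    · rw [dif_neg hT] at hq; exact B.not_mem_surface_of_mem_interiorChart_source hq

open Classical in
/-- **The corner-slice atlas of `X₁`** (normal coordinates `u = -s`, `v = -s - (λ/2) r`). [cite: GayKirby2016, Def. 1 and Fig. 1] [cite: Douady1961, §1 and §4] -/
def atlas₁ : CornerSliceAtlas D.S₁ B.surface (B.uFun D.W₁) (B.vFun D.W₁) B.π where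
  halfDatum p hp := D.halfChart₁ p.1 p.2 hp
  half_mem_source p hp := D.mem_halfChart₁_source p.1 p.2 hp
  half_not_mem _ _ _ hq := D.not_mem_surface_of_mem_halfChart₁_source hq
  cornerDatum p _ :=
    B.cornerSliceChart D.W₁ (chartAt (𝔼 2) (B.zL p.1)) D.εw (IsManifold.chart_mem_maximalAtlas _)
      D.εw_pos D.εw_le_δU D.εw_le_δV D.mem_S₁_iff_of_mem_box D.mem_surface_iff_of_mem_box
  corner_mem_source _ hp :=
    B.mem_cornerSliceChart_source D.W₁ D.εw_pos D.εw_le_δU D.εw_le_δV _ _ (B.mem_box_of_mem_surface D.εw_pos hp)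

/-- **`X₁` straightened satisfies the smooth items of clause (ii).** [cite: GayKirby2016, Def. 1] -/
theorem sector_smooth_clause₁ :
    letI := D.atlas₁.chartedSpace
    IsManifold (𝓡∂ 4) ∞ D.S₁ ∧ Topology.IsEmbedding (Subtype.val : D.S₁ → X) ∧
      range (Subtype.val : D.S₁ → X) = D.S₁ ∧
      (∀ w : D.S₁, w.1 ∉ B.surface → Manifold.IsImmersionAt (𝓡∂ 4) (𝓡 4) ∞ (Subtype.val : D.S₁ → X) w) ∧
      (∀ w : D.S₁, w.1 ∈ B.surface → IsCornerAt (Subtype.val : D.S₁ → X) w) ∧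
      (∀ w : D.S₁, w.1 ∈ B.surface → w ∈ (𝓡∂ 4).boundary D.S₁) :=
  D.atlas₁.sector_smooth_clause

/-- The `0`-th coordinate of the point in its half-slice chart. [folklore] -/
theorem halfChart₁_apply_zero_self (p : X) (hp : p ∈ D.S₁) (hpF : p ∉ B.surface) :
    ((D.halfChart₁ p hp hpF).Θ p 0 = 0 ↔ B.f p - B.a = 0 ∨ D.T p = 2 * (B.f p - B.a)) ∧
      (0 < (D.halfChart₁ p hp hpF).Θ p 0 ↔ B.f p - B.a < 0 ∧ 2 * (B.f p - B.a) < D.T p) := by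
  have hsrc := D.mem_halfChart₁_source p hp hpF
  unfold halfChart₁ at hsrc ⊢
  by_cases hs : B.f p - B.a = 0
  · simp only [dif_pos hs] at hsrc ⊢
    rw [faceChart_apply_zero _ _ _ _ _ _ hsrc]
    constructor
    · exact ⟨fun _ => Or.inl hs, fun _ => by show -(B.f p - B.a) = 0; linarith⟩
    · constructor
      · intro h; exfalso; have : -(B.f p - B.a) > 0 := h; linarith
      · rintro ⟨h1, _⟩; linarith
  · simp only [dif_neg hs] at hsrc ⊢
    by_cases hT : D.T p = 2 * (B.f p - B.a)
    · simp only [dif_pos hT] at hsrc ⊢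
      rw [faceChart_apply_zero _ _ _ _ _ _ hsrc]
      constructor
      · exact ⟨fun _ => Or.inr hT, fun _ => by show -(2 * (B.f p - B.a) - D.T p) = 0; linarith⟩
      · constructor
        · intro h; exfalso; have : -(2 * (B.f p - B.a) - D.T p) > 0 := h; linarith
        · rintro ⟨_, h2⟩; linarith
    · simp only [dif_neg hT] at hsrc ⊢
      have hpos := sublevelChartLT'_apply_zero_pos hsrc.1
      constructor
      · constructor
        · intro h; exact absurd h hpos.ne'
        · rintro (h | h); exacts [absurd h hs, absurd h hT]
      · exact ⟨fun _ => ⟨D.s_neg_of_s_ne_zero₁ hp hs, lt_of_le_of_ne hp.2 (Ne.symm hT)⟩, fun _ => hpos⟩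

/-- **Boundary points of the straightened `X₁` are the points of its faces.** [cite: GayKirby2016, Def. 1] -/
theorem isBoundaryPoint₁_iff (p : D.S₁) :
    letI := D.atlas₁.chartedSpace
    (𝓡∂ 4).IsBoundaryPoint p ↔ B.f p.1 - B.a = 0 ∨ D.T p.1 = 2 * (B.f p.1 - B.a) := by
  letI := D.atlas₁.chartedSpace
  by_cases hpF : p.1 ∈ B.surface
  · have hb := D.atlas₁.isBoundaryPoint_of_mem p hpF
    exact ⟨fun _ => Or.inl (D.sFun_eq_zero_and_T_eq_zero_of_mem_surface hpF).1, fun _ => hb⟩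
  · rw [D.atlas₁.isBoundaryPoint_iff_of_not_mem p hpF]
    exact (D.halfChart₁_apply_zero_self p.1 p.2 hpF).1

/-- **Interior points of the straightened `X₁`: `s < 0` and `2s < T`.** [cite: GayKirby2016, Def. 1] -/
theorem isInteriorPoint₁_iff (p : D.S₁) :
    letI := D.atlas₁.chartedSpace
    (𝓡∂ 4).IsInteriorPoint p ↔ B.f p.1 - B.a < 0 ∧ 2 * (B.f p.1 - B.a) < D.T p.1 := by
  letI := D.atlas₁.chartedSpace
  by_cases hpF : p.1 ∈ B.surface
  · have hb := D.atlas₁.isBoundaryPoint_of_mem p hpF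
    have hs := (D.sFun_eq_zero_and_T_eq_zero_of_mem_surface hpF).1
    constructor
    · intro hi; exact absurd hb (((𝓡∂ 4).isInteriorPoint_iff_not_isBoundaryPoint p).1 hi)
    · rintro ⟨h1, _⟩; exfalso; rw [BiCollar.sFun] at hs; linarith
  · rw [D.atlas₁.isInteriorPoint_iff_of_not_mem p hpF]
    exact (D.halfChart₁_apply_zero_self p.1 p.2 hpF).2

/-! ### The third sector -/

/-- The open set `{T < 2s} ∖ F`. [folklore] -/
def U₃a : Set X := {x | D.T x < 2 * (B.f x - B.a)} ∩ B.surfaceᶜ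
/-- The open set `{T < s} ∖ F`. [folklore] -/
def U₃b : Set X := {x | D.T x < B.f x - B.a} ∩ B.surfaceᶜ

/-- `U₃a` is open. [folklore] -/
theorem isOpen_U₃a : IsOpen D.U₃a :=
  (isOpen_lt D.continuous_T (continuous_const.mul (B.continuous_f'.sub continuous_const))).inter
    B.isClosed_surface.isOpen_compl
/-- `U₃b` is open. [folklore] -/
theorem isOpen_U₃b : IsOpen D.U₃b :=
  (isOpen_lt D.continuous_T (B.continuous_f'.sub continuous_const)).inter B.isClosed_surface.isOpen_compl

/-- On `U₃a`, `X₃ = {T - (f - a) ≤ 0}`. [folklore] -/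
theorem S₃_iff_U₃a : ∀ q ∈ D.U₃a, q ∈ D.S₃ ↔ q ∈ (fun y => D.T y - (B.f y - B.a)) ⁻¹' Iic (0 : ℝ) := by
  intro q hq
  simp only [mem_S₃, mem_preimage, mem_Iic]
  have h0 : D.T q < 2 * (B.f q - B.a) := hq.1
  constructor
  · rintro ⟨_, h2⟩; linarith
  · intro h; exact ⟨h0.le, by linarith⟩

/-- On `U₃b`, `X₃ = {T - 2(f - a) ≤ 0}`. [folklore] -/
theorem S₃_iff_U₃b : ∀ q ∈ D.U₃b, q ∈ D.S₃ ↔ q ∈ (fun y => D.T y - 2 * (B.f y - B.a)) ⁻¹' Iic (0 : ℝ) := by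
  intro q hq
  simp only [mem_S₃, mem_preimage, mem_Iic]
  have h0 : D.T q < B.f q - B.a := hq.1
  constructor
  · rintro ⟨h1, _⟩; linarith
  · intro h; exact ⟨by linarith, h0.le⟩

/-- `T - (f - a)` is smooth. [folklore] -/
theorem contMDiff_T_sub_s : ContMDiff (𝓡 4) 𝓘(ℝ, ℝ) ∞ fun y => D.T y - (B.f y - B.a) :=
  D.contMDiff_T.sub (B.hf.contMDiff.sub contMDiff_const)
/-- `T - 2(f - a)` is smooth. [folklore] -/
theorem contMDiff_T_sub_2s : ContMDiff (𝓡 4) 𝓘(ℝ, ℝ) ∞ fun y => D.T y - 2 * (B.f y - B.a) :=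
  D.contMDiff_T.sub (contMDiff_const.mul (B.hf.contMDiff.sub contMDiff_const))

omit [T2Space X] [CompactSpace X] [IsManifold (𝓡 4) ∞ X] in
/-- Negating a function preserves regularity. [folklore] -/
theorem not_isMCriticalPt_neg_iff {G : X → ℝ} (hG : ContMDiff (𝓡 4) 𝓘(ℝ, ℝ) ∞ G) {p : X} :
    ¬ IsMCriticalPt (𝓡 4) (fun y => -G y) p ↔ ¬ IsMCriticalPt (𝓡 4) G p := by
  rw [isMCriticalPt_real_comp_iff' (hasDerivAt_neg' (G p)) (by norm_num) (hG.mdifferentiableAt (by simp))]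

/-- Regularity of `T - (f - a)` on its zero set off the level. [folklore] -/
theorem reg₁' {p : X} (hT : D.T p = B.f p - B.a) (hp : B.f p ≠ B.a) :
    ¬ IsMCriticalPt (𝓡 4) (fun y => D.T y - (B.f y - B.a)) p := by
  have h := D.reg₁ p hT hp
  have : (fun y => D.T y - (B.f y - B.a)) = fun y => -((B.f y - B.a) - D.T y) := by funext y; ring
  rw [this, not_isMCriticalPt_neg_iff D.contMDiff_s_sub_T]
  exact h

/-- Regularity of `T - 2(f - a)` on its zero set off the level. [folklore] -/
theorem reg₂' {p : X} (hT : D.T p = 2 * (B.f p - B.a)) (hp : B.f p ≠ B.a) :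
    ¬ IsMCriticalPt (𝓡 4) (fun y => D.T y - 2 * (B.f y - B.a)) p := by
  have h := D.reg₂ p hT hp
  have : (fun y => D.T y - 2 * (B.f y - B.a)) = fun y => -(2 * (B.f y - B.a) - D.T y) := by funext y; ring
  rw [this, not_isMCriticalPt_neg_iff D.contMDiff_2s_sub_T]
  exact h

/-- (see name). [folklore] -/
theorem T_lt_2s_of_T_eq_s₃ {p : X} (hp : p ∈ D.S₃) (hpF : p ∉ B.surface) (hT : D.T p = B.f p - B.a) :
    D.T p < 2 * (B.f p - B.a) := by
  rcases hp.1.eq_or_lt with h | h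
  · exact absurd (D.surface_of p (by linarith) (by linarith)) hpF
  · exact h

/-- (see name). [folklore] -/
theorem s_ne_of_T_eq_s₃ {p : X} (hp : p ∈ D.S₃) (hpF : p ∉ B.surface) (hT : D.T p = B.f p - B.a) : B.f p ≠ B.a := by
  intro h; have := D.T_lt_2s_of_T_eq_s₃ hp hpF hT; rw [hT] at this; linarith

/-- (see name). [folklore] -/
theorem T_lt_s_of_T_eq_2s₃ {p : X} (hp : p ∈ D.S₃) (hne : D.T p ≠ B.f p - B.a) : D.T p < B.f p - B.a :=
  lt_of_le_of_ne hp.2 hne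

/-- (see name). [folklore] -/
theorem s_ne_of_T_eq_2s₃ {p : X} (hp : p ∈ D.S₃) (hne : D.T p ≠ B.f p - B.a)
    (hT : D.T p = 2 * (B.f p - B.a)) : B.f p ≠ B.a := by
  intro h; have := D.T_lt_s_of_T_eq_2s₃ hp hne; rw [hT] at this; linarith

/-- **The half-slice chart at a point of `X₃` off the surface.** [cite: Milnor1963, Thm. 3.1] [cite: GayKirby2016, Def. 1] -/
def halfChart₃ (p : X) (hp : p ∈ D.S₃) (hpF : p ∉ B.surface) : HalfSliceChart (𝓡 4) D.S₃ :=
  if hT : D.T p = B.f p - B.a then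
    faceChart D.contMDiff_T_sub_s (D.reg₁' hT (D.s_ne_of_T_eq_s₃ hp hpF hT)) D.S₃ D.U₃a D.isOpen_U₃a D.S₃_iff_U₃a
  else if hT2 : D.T p = 2 * (B.f p - B.a) then
    faceChart D.contMDiff_T_sub_2s (D.reg₂' hT2 (D.s_ne_of_T_eq_2s₃ hp hT hT2)) D.S₃ D.U₃b D.isOpen_U₃b D.S₃_iff_U₃b
  else B.interiorChart D.S₃ p

/-- The point lies in the source of its half-slice chart. [folklore] -/
theorem mem_halfChart₃_source (p : X) (hp : p ∈ D.S₃) (hpF : p ∉ B.surface) :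
    p ∈ (D.halfChart₃ p hp hpF).Θ.source := by
  unfold halfChart₃
  by_cases hT : D.T p = B.f p - B.a
  · rw [dif_pos hT]
    exact mem_faceChart_source _ _ _ _ _ _ ⟨D.T_lt_2s_of_T_eq_s₃ hp hpF hT, hpF⟩
  · rw [dif_neg hT]
    by_cases hT2 : D.T p = 2 * (B.f p - B.a)
    · rw [dif_pos hT2]
      exact mem_faceChart_source _ _ _ _ _ _ ⟨D.T_lt_s_of_T_eq_2s₃ hp hT, hpF⟩
    · rw [dif_neg hT2]
      refine B.mem_interiorChart_source ?_ hpF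
      have h1 : D.T p < 2 * (B.f p - B.a) := lt_of_le_of_ne hp.1 hT2
      have h2 : D.T p < B.f p - B.a := lt_of_le_of_ne hp.2 hT
      have hopen : IsOpen {x | D.T x < 2 * (B.f x - B.a) ∧ D.T x < B.f x - B.a} :=
        (isOpen_lt D.continuous_T (continuous_const.mul (B.continuous_f'.sub continuous_const))).inter
          (isOpen_lt D.continuous_T (B.continuous_f'.sub continuous_const))
      exact mem_of_superset (hopen.mem_nhds ⟨h1, h2⟩) fun x hx => ⟨hx.1.le, hx.2.le⟩

/-- The sources avoid the surface. [folklore] -/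
theorem not_mem_surface_of_mem_halfChart₃_source {p : X} {hp : p ∈ D.S₃} {hpF : p ∉ B.surface} {q : X}
    (hq : q ∈ (D.halfChart₃ p hp hpF).Θ.source) : q ∉ B.surface := by
  unfold halfChart₃ at hq
  by_cases hT : D.T p = B.f p - B.a
  · rw [dif_pos hT] at hq; exact (faceChart_source_subset _ _ _ _ _ _ hq).2
  · rw [dif_neg hT] at hq
    by_cases hT2 : D.T p = 2 * (B.f p - B.a)
    · rw [dif_pos hT2] at hq; exact (faceChart_source_subset _ _ _ _ _ _ hq).2
    · rw [dif_neg hT2] at hq; exact B.not_mem_surface_of_mem_interiorChart_source hq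

open Classical in
/-- **The corner-slice atlas of `X₃`** (normal coordinates `u = s + (λ/2) r`, `v = s + λ r`). [cite: GayKirby2016, Def. 1 and Fig. 1] [cite: Douady1961, §1 and §4] -/
def atlas₃ : CornerSliceAtlas D.S₃ B.surface (B.uFun D.W₃) (B.vFun D.W₃) B.π where
  halfDatum p hp := D.halfChart₃ p.1 p.2 hp
  half_mem_source p hp := D.mem_halfChart₃_source p.1 p.2 hp
  half_not_mem _ _ _ hq := D.not_mem_surface_of_mem_halfChart₃_source hq
  cornerDatum p _ :=
    B.cornerSliceChart D.W₃ (chartAt (𝔼 2) (B.zL p.1)) D.εw (IsManifold.chart_mem_maximalAtlas _)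
      D.εw_pos D.εw_le_δU D.εw_le_δV D.mem_S₃_iff_of_mem_box D.mem_surface_iff_of_mem_box
  corner_mem_source _ hp :=
    B.mem_cornerSliceChart_source D.W₃ D.εw_pos D.εw_le_δU D.εw_le_δV _ _ (B.mem_box_of_mem_surface D.εw_pos hp)

/-- **`X₃` straightened satisfies the smooth items of clause (ii).** [cite: GayKirby2016, Def. 1] -/
theorem sector_smooth_clause₃ :
    letI := D.atlas₃.chartedSpace
    IsManifold (𝓡∂ 4) ∞ D.S₃ ∧ Topology.IsEmbedding (Subtype.val : D.S₃ → X) ∧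
      range (Subtype.val : D.S₃ → X) = D.S₃ ∧
      (∀ w : D.S₃, w.1 ∉ B.surface → Manifold.IsImmersionAt (𝓡∂ 4) (𝓡 4) ∞ (Subtype.val : D.S₃ → X) w) ∧
      (∀ w : D.S₃, w.1 ∈ B.surface → IsCornerAt (Subtype.val : D.S₃ → X) w) ∧
      (∀ w : D.S₃, w.1 ∈ B.surface → w ∈ (𝓡∂ 4).boundary D.S₃) :=
  D.atlas₃.sector_smooth_clause

/-- The `0`-th coordinate of the point in its half-slice chart. [folklore] -/
theorem halfChart₃_apply_zero_self (p : X) (hp : p ∈ D.S₃) (hpF : p ∉ B.surface) :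
    ((D.halfChart₃ p hp hpF).Θ p 0 = 0 ↔ D.T p = B.f p - B.a ∨ D.T p = 2 * (B.f p - B.a)) ∧
      (0 < (D.halfChart₃ p hp hpF).Θ p 0 ↔ D.T p < 2 * (B.f p - B.a) ∧ D.T p < B.f p - B.a) := by
  have hsrc := D.mem_halfChart₃_source p hp hpF
  unfold halfChart₃ at hsrc ⊢
  by_cases hT : D.T p = B.f p - B.a
  · simp only [dif_pos hT] at hsrc ⊢
    rw [faceChart_apply_zero _ _ _ _ _ _ hsrc]
    constructor
    · exact ⟨fun _ => Or.inl hT, fun _ => by show -(D.T p - (B.f p - B.a)) = 0; linarith⟩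
    · constructor
      · intro h; exfalso; have : -(D.T p - (B.f p - B.a)) > 0 := h; linarith
      · rintro ⟨_, h2⟩; linarith
  · simp only [dif_neg hT] at hsrc ⊢
    by_cases hT2 : D.T p = 2 * (B.f p - B.a)
    · simp only [dif_pos hT2] at hsrc ⊢
      rw [faceChart_apply_zero _ _ _ _ _ _ hsrc]
      constructor
      · exact ⟨fun _ => Or.inr hT2, fun _ => by show -(D.T p - 2 * (B.f p - B.a)) = 0; linarith⟩
      · constructor
        · intro h; exfalso; have : -(D.T p - 2 * (B.f p - B.a)) > 0 := h; linarith
        · rintro ⟨h1, _⟩; linarith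
    · simp only [dif_neg hT2] at hsrc ⊢
      have hpos := sublevelChartLT'_apply_zero_pos hsrc.1
      constructor
      · constructor
        · intro h; exact absurd h hpos.ne'
        · rintro (h | h); exacts [absurd h hT, absurd h hT2]
      · exact ⟨fun _ => ⟨lt_of_le_of_ne hp.1 hT2, lt_of_le_of_ne hp.2 hT⟩, fun _ => hpos⟩

/-- **Boundary points of the straightened `X₃` are the points of its faces.** [cite: GayKirby2016, Def. 1] -/
theorem isBoundaryPoint₃_iff (p : D.S₃) :
    letI := D.atlas₃.chartedSpace
    (𝓡∂ 4).IsBoundaryPoint p ↔ D.T p.1 = B.f p.1 - B.a ∨ D.T p.1 = 2 * (B.f p.1 - B.a) := by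
  letI := D.atlas₃.chartedSpace
  by_cases hpF : p.1 ∈ B.surface
  · have hb := D.atlas₃.isBoundaryPoint_of_mem p hpF
    obtain ⟨hs, hT⟩ := D.sFun_eq_zero_and_T_eq_zero_of_mem_surface hpF
    rw [BiCollar.sFun] at hs
    exact ⟨fun _ => Or.inl (by rw [hT, hs]), fun _ => hb⟩
  · rw [D.atlas₃.isBoundaryPoint_iff_of_not_mem p hpF]
    exact (D.halfChart₃_apply_zero_self p.1 p.2 hpF).1

/-- **Interior points of the straightened `X₃`: `T < 2s` and `T < s`.** [cite: GayKirby2016, Def. 1] -/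
theorem isInteriorPoint₃_iff (p : D.S₃) :
    letI := D.atlas₃.chartedSpace
    (𝓡∂ 4).IsInteriorPoint p ↔ D.T p.1 < 2 * (B.f p.1 - B.a) ∧ D.T p.1 < B.f p.1 - B.a := by
  letI := D.atlas₃.chartedSpace
  by_cases hpF : p.1 ∈ B.surface
  · have hb := D.atlas₃.isBoundaryPoint_of_mem p hpF
    obtain ⟨hs, hT⟩ := D.sFun_eq_zero_and_T_eq_zero_of_mem_surface hpF
    rw [BiCollar.sFun] at hs
    constructor
    · intro hi; exact absurd hb (((𝓡∂ 4).isInteriorPoint_iff_not_isBoundaryPoint p).1 hi)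
    · rintro ⟨_, h2⟩; exfalso; rw [hT, hs] at h2; exact lt_irrefl _ h2
  · rw [D.atlas₃.isInteriorPoint_iff_of_not_mem p hpF]
    exact (D.halfChart₃_apply_zero_self p.1 p.2 hpF).2

end TwoFnData

end BiCollar

end Literature.Topology.FourManifolds

end
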